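import Literature.MathematicalPhysics.QuantumLattice.DWaveSourceFreePressure
import Literature.MathematicalPhysics.QuantumLattice.TorusFermiWeightSum
import Literature.MathematicalPhysics.QuantumLattice.BdGModeGainBound

/-!
# Route `ThermalWedge`, crux `TwSourcedCondensation` (item `stmt-HubbardSuperconductivity-1697`):
# the free linear thermal law (stub of line `entropy-staircase-linear-regime`)

For the `U = 0` Hubbard torus with the uniform `d_{x²-y²}` pair source `-h(Δ_d + Δ_d†)`
(`dWaveSourceTorus L 0 μ h`) we PROVE the Sommerfeld-type UPPER bound on the dyadic HEAT CHORD of the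
sourced pressure: for every compact `[μ₁, μ₂] ⊂ (-4, 0)` there is `C₁ > 0` with

  `p̃_L(β/2, h) - p̃_L(β, h) ≤ C₁/β²`,  `p̃_L(b, h) = log Re Z_b(dWaveSourceTorus L 0 μ h)/(bL²)`,

for all `β ≥ 1`, `μ ∈ [μ₁, μ₂]`, all `L ≥ max(3, ⌈β⌉)` and all `|h| ≤ 1/β` (in fact uniformly in `h`)
(`stub_freeLinearThermalLaw`, registered signature of the skeleton
`Lines/entropy-staircase-linear-regime.lean` of the crux: the entropy staircase trades a source above
the temperature for a hotter system and pays this chord).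

Proof. By the BdG product formula (`partitionFn_dWaveSourceTorus_zero_re`, `L ≥ 3`)
`log Z_b = 2L² log 2 + Σ_k [-bξ_k + log((1 + cosh bE_k)/2)]`, `ξ_k = ε_L(k) - μ`,
`E_k² = ξ_k² + 8h²ĝ_d(k)²` (`log_partitionFn_dWaveSourceTorus_zero_re`). In
`βL² · chord = 2 log Z_{β/2} - log Z_β` the `-bξ_k` terms cancel and the prefactor leaves `Σ_k 2 log 2`,
so per mode, with `y = βE_k` and `(1 + cosh y)/2 = cosh²(y/2)`,
`2 log 2 + 2 log((1 + cosh(y/2))/2) - log((1 + cosh y)/2) = 2 log(1 + sech(y/2)) ≤ 2 sech(y/2) ≤ 4e^{-y/2}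
 ≤ 4e^{-β|ξ_k|/2}` (`heatChordMode_le`, `bdgHeatChordMode_le`, `two_mul_log_partitionFn_half_sub_le`).
The remaining BOLTZMANN SHELL SUM `Σ_k e^{-B|ξ_k|} ≤ A(d₀)(L²/B + L)` (`exists_sum_boltzmannWeight_le`,
`B = β/2`, `d₀ = min(μ₁ + 4, -μ₂)`) follows from the torus level counting `card_torusShell_le`
(`#{k : |ξ_k| < η} ≤ 4L(ηL/(2π√(d₀/8)) + 1)`, `η ≤ d₀/2`) by the log-free dyadic domination
`e^{-Bt} ≤ 1/(Bη₀) + Σ_{j ≤ J} (8/4^j)𝟙[t < 2^j/B]` (`boltzmannWeight_le_dyadic`, from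
`e^{-x} ≤ 2/(1 + x)²`), exactly as the Fermi-weight sum of `TorusFermiWeightSum.lean` but with summable
weights `8/4^j` against the shell counts `≍ 2^j L²/B + L`. Finally
`chord ≤ 4A(2L²/β + L)/(βL²) ≤ 12A/β²` for `L ≥ β`. Constants: `C₁ = 12A`,
`A = 4/d₀ + 32/(π√(d₀/8)) + 64`, `L₀ = max(3, ⌈β⌉)`.

Sources: A. Sommerfeld, Z. Phys. 47 (1928) 1 (linear electronic specific heat); J. Bardeen,
L. N. Cooper, J. R. Schrieffer, Phys. Rev. 108 (1957) 1175 §III (BdG free energy); M. Salmhofer,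
*Renormalization* (1999) §4.5.4 (density of states of the `d = 2` band away from its critical
energies). Folklore estimates; no definition, no named fact.
-/

noncomputable section

namespace Summit.HubbardSuperconductivity.HubbardSuperconductivity.Theorems

open Matrix Finset Real Literature.MathematicalPhysics.QuantumLattice Literature.Probability.LatticeModels

/-! ### The Boltzmann shell sum `Σ_k e^{-B|ξ_k|}` on the torus -/

/-- `e^{-x} ≤ 2/(1 + x)²` for `x ≥ 0` (from `1 + x + x²/2 ≤ e^x`). [folklore] -/
theorem exp_neg_le_two_div_sq {x : ℝ} (hx : 0 ≤ x) : Real.exp (-x) ≤ 2 / (1 + x) ^ 2 := by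
  have h := Real.quadratic_le_exp_of_nonneg hx
  rw [le_div_iff₀ (by positivity), Real.exp_neg, inv_mul_le_iff₀ (Real.exp_pos x)]
  linarith

/-- `e^{-x} ≤ 1/x` for `x > 0`. [folklore] -/
theorem exp_neg_le_one_div {x : ℝ} (hx : 0 < x) : Real.exp (-x) ≤ 1 / x := by
  rw [le_div_iff₀ hx, Real.exp_neg, inv_mul_le_iff₀ (Real.exp_pos x), mul_one]
  linarith [Real.add_one_le_exp x]

/-- `4^j = 2^j · 2^j` in `ℝ`. [folklore] -/
theorem four_pow_eq_two_pow_mul_two_pow (j : ℕ) : (4 : ℝ) ^ j = 2 ^ j * 2 ^ j := by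
  rw [← mul_pow]; norm_num

/-- Pointwise dyadic domination of the Boltzmann weight `e^{-Bt}` (`B > 0`, `t ≥ 0`): for a cut-off
`η₀ > 0` and `J` with `η₀ ≤ 2^J/B`,
`e^{-Bt} ≤ 1/(Bη₀) + Σ_{j ≤ J} (8/4^j)·𝟙[t < 2^j/B]` (log-free: the weights `8/4^j` are summable
against the shell counts `≍ 2^j`). [folklore] -/
theorem boltzmannWeight_le_dyadic {B t η₀ : ℝ} (hB : 0 < B) (ht : 0 ≤ t) (hη₀ : 0 < η₀) {J : ℕ}
    (hJ : η₀ ≤ 2 ^ J / B) :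
    Real.exp (-(B * t)) ≤ 1 / (B * η₀) +
      ∑ j ∈ Finset.range (J + 1), (if t < 2 ^ j / B then 8 / 4 ^ j else 0) := by
  have hsum_nonneg : 0 ≤ ∑ j ∈ Finset.range (J + 1), (if t < 2 ^ j / B then (8 : ℝ) / 4 ^ j else 0) :=
    Finset.sum_nonneg fun j _ => by split_ifs <;> positivity
  by_cases hcase : η₀ ≤ t
  · have h1 : Real.exp (-(B * t)) ≤ 1 / (B * η₀) := by
      have h2 : Real.exp (-(B * t)) ≤ Real.exp (-(B * η₀)) :=
        Real.exp_le_exp.2 (by nlinarith [mul_le_mul_of_nonneg_left hcase hB.le])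
      exact h2.trans (exp_neg_le_one_div (by positivity))
    linarith
  · rw [not_le] at hcase
    have hex : ∃ j : ℕ, t < 2 ^ j / B := ⟨J, hcase.trans_le hJ⟩
    classical
    set i := Nat.find hex with hi
    have hi_spec : t < 2 ^ i / B := Nat.find_spec hex
    have hi_le : i ≤ J := Nat.find_min' hex (hcase.trans_le hJ)
    have hterm : Real.exp (-(B * t)) ≤ 8 / 4 ^ i := by
      rcases Nat.eq_zero_or_pos i with h0 | hpos
      · rw [h0, pow_zero]
        have : Real.exp (-(B * t)) ≤ 1 := Real.exp_le_one_iff.2 (by nlinarith)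
        linarith
      · obtain ⟨i', hi'⟩ := Nat.exists_eq_add_one_of_ne_zero hpos.ne'
        have hlt : i' < Nat.find hex := by rw [← hi, hi']; exact Nat.lt_succ_self i'
        have hnot : ¬ t < 2 ^ i' / B := Nat.find_min hex hlt
        rw [not_lt, div_le_iff₀ hB] at hnot
        rw [hi']
        calc Real.exp (-(B * t)) ≤ 2 / (1 + B * t) ^ 2 := exp_neg_le_two_div_sq (by positivity)
          _ ≤ 2 / ((2 : ℝ) ^ i') ^ 2 := by
              gcongr
              linarith
          _ = 8 / 4 ^ (i' + 1) := by
              rw [pow_succ, four_pow_eq_two_pow_mul_two_pow]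
              field_simp
              ring
    have hsingle : (8 / 4 ^ i : ℝ) ≤ ∑ j ∈ Finset.range (J + 1), (if t < 2 ^ j / B then 8 / 4 ^ j else 0) := by
      have := Finset.single_le_sum (f := fun j => (if t < 2 ^ j / B then (8 : ℝ) / 4 ^ j else 0))
        (fun j _ => by split_ifs <;> positivity) (Finset.mem_range.2 (Nat.lt_succ_of_le hi_le))
      simpa [hi_spec] using this
    have : 0 ≤ 1 / (B * η₀) := by positivity
    linarith

/-- **The Boltzmann shell sum on the torus.** For `d₀ > 0` there is `A = A(d₀)` such that for every
`μ` with `μ + 4 ≥ d₀`, `-μ ≥ d₀`, every `B > 0` and every `L ≥ 1`,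
`Σ_{k ∈ (ℤ/Lℤ)²} e^{-B|ε_L(k) - μ|} ≤ A (L²/B + L)`: the density of states of the square-lattice band is
bounded away from `{-4, 0, 4}` (`card_torusShell_le`), so the Boltzmann tail of width `1/B` around the
Fermi curve carries `≲ L²/B` momenta, up to the `O(L)` lattice discrepancy. [folklore] -/
theorem exists_sum_boltzmannWeight_le {d₀ : ℝ} (hd₀ : 0 < d₀) :
    ∃ A : ℝ, 0 < A ∧ ∀ μ : ℝ, d₀ ≤ μ + 4 → d₀ ≤ -μ → ∀ B : ℝ, 0 < B → ∀ (L : ℕ) [NeZero L],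
      ∑ k : TorusSite 2 L, Real.exp (-(B * |torusBand L k - μ|)) ≤
        A * ((L : ℝ) ^ 2 / B + L) := by
  set s₀ := Real.sqrt (d₀ / 8) with hs₀def
  have hs₀ : 0 < s₀ := Real.sqrt_pos.2 (by positivity)
  refine ⟨4 / d₀ + 32 / (π * s₀) + 64, by positivity, ?_⟩
  intro μ hμ4 hμ0 B hB L _
  have hL : (0 : ℝ) < L := by exact_mod_cast Nat.pos_of_ne_zero (NeZero.ne L)
  set η₀ := d₀ / 4 with hη₀def
  have hη₀ : 0 < η₀ := by positivity
  have hcardL : (Finset.univ : Finset (TorusSite 2 L)).card = L ^ 2 := by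
    rw [Finset.card_univ, Fintype.card_pi, Fin.prod_univ_two, ZMod.card, sq]
  have hA1 : (0 : ℝ) ≤ 32 / (π * s₀) * ((L : ℝ) ^ 2 / B) := by positivity
  have hA2 : (0 : ℝ) ≤ (4 / d₀ + 32 / (π * s₀)) * L := by positivity
  have hA3 : (0 : ℝ) ≤ 64 * ((L : ℝ) ^ 2 / B) := by positivity
  have hη₀' : (L : ℝ) ^ 2 / (B * η₀) = 4 / d₀ * ((L : ℝ) ^ 2 / B) := by
    rw [hη₀def]; field_simp
  by_cases hsmall : B * η₀ ≤ 1
  · -- small `B`: every weight is `≤ 1 ≤ 1/(Bη₀)`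
    have hbound : ∀ k : TorusSite 2 L, Real.exp (-(B * |torusBand L k - μ|)) ≤ 1 / (B * η₀) := fun k => by
      refine (Real.exp_le_one_iff.2 ?_).trans ?_
      · have := abs_nonneg (torusBand L k - μ)
        nlinarith
      · rw [le_div_iff₀ (by positivity)]; linarith
    calc ∑ k : TorusSite 2 L, Real.exp (-(B * |torusBand L k - μ|)) ≤ ∑ _k : TorusSite 2 L, 1 / (B * η₀) :=
          Finset.sum_le_sum fun k _ => hbound k
      _ = 4 / d₀ * ((L : ℝ) ^ 2 / B) := by
          rw [Finset.sum_const, hcardL, nsmul_eq_mul, ← hη₀']; push_cast; ring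
      _ ≤ (4 / d₀ + 32 / (π * s₀) + 64) * ((L : ℝ) ^ 2 / B + L) := by linarith [hA1, hA2, hA3]
  · -- dyadic decomposition
    rw [not_le] at hsmall
    obtain ⟨n, hn1, hn2⟩ := exists_nat_pow_near hsmall.le one_lt_two
    set J := n + 1 with hJdef
    have hJ1 : η₀ ≤ 2 ^ J / B := by
      rw [le_div_iff₀ hB, hJdef]; linarith
    have hJ2 : (2 : ℝ) ^ J / B ≤ d₀ / 2 := by
      rw [div_le_iff₀ hB, hJdef, pow_succ]; nlinarith
    have hpt : ∀ k : TorusSite 2 L, Real.exp (-(B * |torusBand L k - μ|)) ≤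
        1 / (B * η₀) + ∑ j ∈ Finset.range (J + 1), (if |torusBand L k - μ| < 2 ^ j / B then 8 / 4 ^ j else 0) :=
      fun k => boltzmannWeight_le_dyadic hB (abs_nonneg _) hη₀ hJ1
    have hcount : ∀ j ∈ Finset.range (J + 1),
        ∑ k : TorusSite 2 L, (if |torusBand L k - μ| < 2 ^ j / B then 8 / 4 ^ j else (0 : ℝ)) ≤
          (16 * (L : ℝ) ^ 2 / (π * s₀ * B) + 32 * L) / 2 ^ j := by
      intro j hj
      have hjJ : j ≤ J := Nat.lt_succ_iff.1 (Finset.mem_range.1 hj)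
      have hηj : 0 < (2 : ℝ) ^ j / B := by positivity
      have hηj' : (2 : ℝ) ^ j / B ≤ d₀ / 2 :=
        le_trans (div_le_div_of_nonneg_right (pow_le_pow_right₀ one_le_two hjJ) hB.le) hJ2
      have hN := card_torusShell_le (L := L) hμ4 hμ0 hηj hηj'
      rw [← hs₀def] at hN
      rw [← Finset.sum_filter, Finset.sum_const, nsmul_eq_mul]
      have h2j : (1 : ℝ) ≤ 2 ^ j := one_le_pow₀ one_le_two
      calc (((Finset.univ.filter fun k : TorusSite 2 L => |torusBand L k - μ| < 2 ^ j / B).card : ℕ) : ℝ) * (8 / 4 ^ j)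
          ≤ 4 * (L * (2 ^ j / B * L / (2 * π * s₀) + 1)) * (8 / 4 ^ j) :=
            mul_le_mul_of_nonneg_right hN (by positivity)
        _ = (16 * (L : ℝ) ^ 2 / (π * s₀ * B) + 32 * L / 2 ^ j) / 2 ^ j := by
            rw [four_pow_eq_two_pow_mul_two_pow]
            field_simp
            ring
        _ ≤ (16 * (L : ℝ) ^ 2 / (π * s₀ * B) + 32 * L) / 2 ^ j := by
            gcongr
            exact div_le_self (by positivity) h2j
    have hgeom : ∑ j ∈ Finset.range (J + 1), (16 * (L : ℝ) ^ 2 / (π * s₀ * B) + 32 * L) / 2 ^ j ≤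
        2 * (16 * (L : ℝ) ^ 2 / (π * s₀ * B) + 32 * L) := by
      have hg := geom_sum_Ico_le_of_lt_one (show (0 : ℝ) ≤ 1 / 2 by norm_num) (show (1 : ℝ) / 2 < 1 by norm_num)
        (m := 0) (n := J + 1)
      simp only [pow_zero, Finset.range_eq_Ico] at hg ⊢
      have hK : (0 : ℝ) ≤ 16 * (L : ℝ) ^ 2 / (π * s₀ * B) + 32 * L := by positivity
      calc ∑ j ∈ Finset.Ico 0 (J + 1), (16 * (L : ℝ) ^ 2 / (π * s₀ * B) + 32 * L) / 2 ^ j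
          = (16 * (L : ℝ) ^ 2 / (π * s₀ * B) + 32 * L) * ∑ j ∈ Finset.Ico 0 (J + 1), ((1 : ℝ) / 2) ^ j := by
            rw [Finset.mul_sum]
            refine Finset.sum_congr rfl fun j _ => ?_
            rw [one_div, inv_pow]; ring
        _ ≤ (16 * (L : ℝ) ^ 2 / (π * s₀ * B) + 32 * L) * (1 / (1 - 1 / 2)) := by gcongr
        _ = 2 * (16 * (L : ℝ) ^ 2 / (π * s₀ * B) + 32 * L) := by norm_num; ring
    calc ∑ k : TorusSite 2 L, Real.exp (-(B * |torusBand L k - μ|))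
        ≤ ∑ k : TorusSite 2 L, (1 / (B * η₀) + ∑ j ∈ Finset.range (J + 1),
            (if |torusBand L k - μ| < 2 ^ j / B then 8 / 4 ^ j else 0)) := Finset.sum_le_sum fun k _ => hpt k
      _ = (L : ℝ) ^ 2 / (B * η₀) + ∑ j ∈ Finset.range (J + 1), ∑ k : TorusSite 2 L,
            (if |torusBand L k - μ| < 2 ^ j / B then 8 / 4 ^ j else (0 : ℝ)) := by
          rw [Finset.sum_add_distrib, Finset.sum_const, hcardL, nsmul_eq_mul, Finset.sum_comm]
          push_cast; ring
      _ ≤ (L : ℝ) ^ 2 / (B * η₀) + ∑ j ∈ Finset.range (J + 1), (16 * (L : ℝ) ^ 2 / (π * s₀ * B) + 32 * L) / 2 ^ j := by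
          gcongr with j hj
          exact hcount j hj
      _ ≤ (L : ℝ) ^ 2 / (B * η₀) + 2 * (16 * (L : ℝ) ^ 2 / (π * s₀ * B) + 32 * L) := by gcongr
      _ = 4 / d₀ * ((L : ℝ) ^ 2 / B) + 32 / (π * s₀) * ((L : ℝ) ^ 2 / B) + 64 * L := by
          rw [hη₀']
          field_simp
          ring
      _ ≤ (4 / d₀ + 32 / (π * s₀) + 64) * ((L : ℝ) ^ 2 / B + L) := by linarith [hA2, hA3]

/-! ### The dyadic heat chord of one BdG mode -/

/-- `sech z ≤ 2e^{-z}`: `2/cosh z ≤ 4 e^{-z}` (`2cosh z ≥ e^{z}`). [folklore] -/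
theorem two_div_cosh_le (z : ℝ) : 2 / Real.cosh z ≤ 4 * Real.exp (-z) := by
  have hc := Real.cosh_pos z
  rw [div_le_iff₀ hc, Real.cosh_eq]
  have h1 : Real.exp (-z) * Real.exp z = 1 := by rw [← Real.exp_add]; simp
  nlinarith [sq_nonneg (Real.exp (-z)), h1]

/-- **The dyadic heat chord of one mode.** For every real `y`,
`2 log 2 + 2 log((1 + cosh(y/2))/2) - log((1 + cosh y)/2) ≤ 4 e^{-y/2}`: with
`(1 + cosh y)/2 = cosh²(y/2)` the left side is `2 log(1 + sech(y/2)) ≤ 2 sech(y/2) ≤ 4e^{-y/2}`. [folklore] -/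
theorem heatChordMode_le (y : ℝ) :
    2 * Real.log 2 + 2 * Real.log ((1 + Real.cosh (y / 2)) / 2) - Real.log ((1 + Real.cosh y) / 2) ≤
      4 * Real.exp (-(y / 2)) := by
  have hc : 0 < Real.cosh (y / 2) := Real.cosh_pos _
  have h1c : (1 + Real.cosh (y / 2)) ≠ 0 := by positivity
  rw [log_one_add_cosh_div_two y, Real.log_div h1c two_ne_zero]
  have key : Real.log (1 + Real.cosh (y / 2)) - Real.log (Real.cosh (y / 2)) ≤ 1 / Real.cosh (y / 2) := by
    rw [← Real.log_div h1c hc.ne']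
    calc Real.log ((1 + Real.cosh (y / 2)) / Real.cosh (y / 2))
        ≤ (1 + Real.cosh (y / 2)) / Real.cosh (y / 2) - 1 := Real.log_le_sub_one_of_pos (by positivity)
      _ = 1 / Real.cosh (y / 2) := by field_simp; ring
  have h2 := two_div_cosh_le (y / 2)
  have h3 : 2 * (1 / Real.cosh (y / 2)) = 2 / Real.cosh (y / 2) := by ring
  linarith

/-- The heat chord of the BdG mode `(ξ, D)` between inverse temperatures `β/2` and `β` (`β ≥ 0`) is at
most `4 e^{-β|ξ|/2}`, uniformly in the gap `D` (`E = √(ξ² + D²) ≥ |ξ|`). [folklore] -/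
theorem bdgHeatChordMode_le {β : ℝ} (hβ : 0 ≤ β) (ξ D : ℝ) :
    2 * Real.log 2 + 2 * Real.log ((1 + Real.cosh (β / 2 * Real.sqrt (ξ ^ 2 + D ^ 2))) / 2) -
        Real.log ((1 + Real.cosh (β * Real.sqrt (ξ ^ 2 + D ^ 2))) / 2) ≤
      4 * Real.exp (-(β / 2 * |ξ|)) := by
  have hξE : |ξ| ≤ Real.sqrt (ξ ^ 2 + D ^ 2) := by
    rw [← Real.sqrt_sq_eq_abs]
    exact Real.sqrt_le_sqrt (by nlinarith [sq_nonneg D])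
  have h := heatChordMode_le (β * Real.sqrt (ξ ^ 2 + D ^ 2))
  rw [show β * Real.sqrt (ξ ^ 2 + D ^ 2) / 2 = β / 2 * Real.sqrt (ξ ^ 2 + D ^ 2) by ring] at h
  have hexp : Real.exp (-(β / 2 * Real.sqrt (ξ ^ 2 + D ^ 2))) ≤ Real.exp (-(β / 2 * |ξ|)) :=
    Real.exp_le_exp.2 (by nlinarith [mul_le_mul_of_nonneg_left hξE (by positivity : 0 ≤ β / 2)])
  linarith

/-! ### The free sourced torus: `log Z` and the heat chord -/

section Torus

variable {L : ℕ} [NeZero L]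

/-- `log Re Tr e^{-b H_L(s)}` of the `U = 0` `d`-wave-sourced torus (`L ≥ 3`) from the BdG product
formula `partitionFn_dWaveSourceTorus_zero_re`:
`log Z_b = |Orb| log 2 + Σ_k [-bξ_k + log((1 + cosh(bE_k))/2)]`. [folklore] -/
theorem log_partitionFn_dWaveSourceTorus_zero_re (hL : 3 ≤ L) (b μ s : ℝ) :
    Real.log (partitionFn b (dWaveSourceTorus L 0 μ s)).re =
      (Fintype.card (Orb (FermionTorus 2 L)) : ℝ) * Real.log 2 +
        ∑ k : TorusSite 2 L, (-(b * (torusBand L k - μ)) +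
          Real.log ((1 + Real.cosh (b * Real.sqrt ((torusBand L k - μ) ^ 2 +
            (2 * Real.sqrt 2 * s * dWaveGap k) ^ 2))) / 2)) := by
  rw [partitionFn_dWaveSourceTorus_zero_re hL]
  have hpow : (0 : ℝ) < (2 : ℝ) ^ Fintype.card (Orb (FermionTorus 2 L)) := by positivity
  have hfac : ∀ k : TorusSite 2 L, Real.exp (-(b * (torusBand L k - μ))) *
      ((1 + Real.cosh (b * Real.sqrt ((torusBand L k - μ) ^ 2 + (2 * Real.sqrt 2 * s * dWaveGap k) ^ 2))) / 2) ≠ 0 :=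
    fun k => (bdgModeFactor_pos b _ _).ne'
  rw [Real.log_mul hpow.ne' (Finset.prod_ne_zero_iff.2 fun k _ => hfac k), Real.log_pow,
    Real.log_prod (s := Finset.univ) (hf := fun k _ => hfac k)]
  congr 1
  refine Finset.sum_congr rfl fun k _ => ?_
  have hcosh : 0 < (1 + Real.cosh (b * Real.sqrt ((torusBand L k - μ) ^ 2 + (2 * Real.sqrt 2 * s * dWaveGap k) ^ 2))) / 2 := by
    have := Real.one_le_cosh (b * Real.sqrt ((torusBand L k - μ) ^ 2 + (2 * Real.sqrt 2 * s * dWaveGap k) ^ 2))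
    positivity
  rw [Real.log_mul (Real.exp_pos _).ne' hcosh.ne', Real.log_exp]

/-- **The dyadic heat chord of the free sourced torus** (`L ≥ 3`, `β ≥ 0`):
`2 log Z_{β/2} - log Z_β ≤ 4 Σ_k e^{-β|ξ_k|/2}` — the `2^{2L²}` prefactors leave `Σ_k 2 log 2`, the
`e^{-bξ_k}` factors cancel, and each mode contributes `2 log(1 + sech(βE_k/2)) ≤ 4e^{-β|ξ_k|/2}`
(`bdgHeatChordMode_le`), uniformly in the source `s`. [folklore] -/
theorem two_mul_log_partitionFn_half_sub_le (hL : 3 ≤ L) {β : ℝ} (hβ : 0 ≤ β) (μ s : ℝ) :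
    2 * Real.log (partitionFn (β / 2) (dWaveSourceTorus L 0 μ s)).re -
        Real.log (partitionFn β (dWaveSourceTorus L 0 μ s)).re ≤
      ∑ k : TorusSite 2 L, 4 * Real.exp (-(β / 2 * |torusBand L k - μ|)) := by
  rw [log_partitionFn_dWaveSourceTorus_zero_re hL, log_partitionFn_dWaveSourceTorus_zero_re hL]
  have hcardL : (Finset.univ : Finset (TorusSite 2 L)).card = L ^ 2 := by
    rw [Finset.card_univ, Fintype.card_pi, Fin.prod_univ_two, ZMod.card, sq]
  have hL2 : (Fintype.card (Orb (FermionTorus 2 L)) : ℝ) * Real.log 2 = ∑ _k : TorusSite 2 L, 2 * Real.log 2 := by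
    rw [Finset.sum_const, hcardL, card_orb_fermionTorus_two, nsmul_eq_mul]
    push_cast
    ring
  set a : TorusSite 2 L → ℝ := fun k => -(β / 2 * (torusBand L k - μ)) +
      Real.log ((1 + Real.cosh (β / 2 * Real.sqrt ((torusBand L k - μ) ^ 2 +
        (2 * Real.sqrt 2 * s * dWaveGap k) ^ 2))) / 2) with ha
  set c : TorusSite 2 L → ℝ := fun k => -(β * (torusBand L k - μ)) +
      Real.log ((1 + Real.cosh (β * Real.sqrt ((torusBand L k - μ) ^ 2 +
        (2 * Real.sqrt 2 * s * dWaveGap k) ^ 2))) / 2) with hc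
  calc 2 * ((Fintype.card (Orb (FermionTorus 2 L)) : ℝ) * Real.log 2 + ∑ k, a k) -
        ((Fintype.card (Orb (FermionTorus 2 L)) : ℝ) * Real.log 2 + ∑ k, c k)
      = (Fintype.card (Orb (FermionTorus 2 L)) : ℝ) * Real.log 2 + (2 * ∑ k, a k - ∑ k, c k) := by ring
    _ = ∑ k, (2 * Real.log 2 + (2 * a k - c k)) := by
        rw [hL2, Finset.mul_sum, ← Finset.sum_sub_distrib, ← Finset.sum_add_distrib]
    _ ≤ ∑ k : TorusSite 2 L, 4 * Real.exp (-(β / 2 * |torusBand L k - μ|)) := by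
        refine Finset.sum_le_sum fun k _ => ?_
        have hm := bdgHeatChordMode_le hβ (torusBand L k - μ) (2 * Real.sqrt 2 * s * dWaveGap k)
        simp only [ha, hc]
        linarith

end Torus

/-! ### The stub -/

/-- **Stub of line `entropy-staircase-linear-regime`: the free linear thermal law.** For every compact
`[μ₁, μ₂] ⊂ (-4, 0)` there is `C₁ > 0` such that for all `β ≥ 1`, `μ ∈ [μ₁, μ₂]`, eventually in `L`
(threshold `max(3, ⌈β⌉)`) and all `|h| ≤ 1/β`, the dyadic heat chord of the `U = 0` `d`-wave-sourced
Hubbard torus is `p̃_L(β/2,h) - p̃_L(β,h) ≤ C₁/β²`, `p̃_L(b,h) = log Re Z_b(dWaveSourceTorus L 0 μ h)/(bL²)`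
(Sommerfeld: the free specific heat is linear in the temperature away from the band edges and the
van Hove energy; the bound is uniform in the source). [folklore] -/
theorem stub_freeLinearThermalLaw :
    ∀ μ₁ μ₂ : ℝ, -4 < μ₁ → μ₁ ≤ μ₂ → μ₂ < 0 → ∃ C₁ : ℝ, 0 < C₁ ∧ ∀ β : ℝ, 1 ≤ β → ∀ μ ∈ Set.Icc μ₁ μ₂,
      ∃ L₀ : ℕ, ∀ (L : ℕ) [NeZero L], L₀ ≤ L → ∀ h : ℝ, |h| ≤ 1 / β →
      Real.log (Matrix.partitionFn (β / 2) (Literature.MathematicalPhysics.QuantumLattice.dWaveSourceTorus L 0 μ h)).re / (β / 2 * (L : ℝ) ^ 2) -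
        Real.log (Matrix.partitionFn β (Literature.MathematicalPhysics.QuantumLattice.dWaveSourceTorus L 0 μ h)).re / (β * (L : ℝ) ^ 2) ≤ C₁ / β ^ 2 := by
  intro μ₁ μ₂ h4 _h12 h0
  have hd₀ : 0 < min (μ₁ + 4) (-μ₂) := lt_min (by linarith) (by linarith)
  obtain ⟨A, hA, hsum⟩ := exists_sum_boltzmannWeight_le hd₀
  refine ⟨12 * A, by positivity, ?_⟩
  intro β hβ μ hμ
  have hβ0 : 0 < β := by linarith
  have hμ4 : min (μ₁ + 4) (-μ₂) ≤ μ + 4 := (min_le_left _ _).trans (by linarith [hμ.1])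
  have hμ0 : min (μ₁ + 4) (-μ₂) ≤ -μ := (min_le_right _ _).trans (by linarith [hμ.2])
  refine ⟨max 3 ⌈β⌉₊, fun L _ hL h _ => ?_⟩
  have hL3 : 3 ≤ L := le_of_max_le_left hL
  have hLβ : β ≤ (L : ℝ) := Nat.ceil_le.mp (le_of_max_le_right hL)
  have hLpos : (0 : ℝ) < L := by exact_mod_cast Nat.pos_of_ne_zero (NeZero.ne L)
  have hchord : Real.log (partitionFn (β / 2) (dWaveSourceTorus L 0 μ h)).re / (β / 2 * (L : ℝ) ^ 2) -
      Real.log (partitionFn β (dWaveSourceTorus L 0 μ h)).re / (β * (L : ℝ) ^ 2) =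
      (2 * Real.log (partitionFn (β / 2) (dWaveSourceTorus L 0 μ h)).re -
        Real.log (partitionFn β (dWaveSourceTorus L 0 μ h)).re) / (β * (L : ℝ) ^ 2) := by
    field_simp
  rw [hchord, div_le_div_iff₀ (by positivity) (by positivity)]
  have hS := hsum μ hμ4 hμ0 (β / 2) (by positivity) L
  have hkey := two_mul_log_partitionFn_half_sub_le hL3 hβ0.le μ h
  have hALβ : A * L * β ≤ A * L * L := mul_le_mul_of_nonneg_left hLβ (by positivity)
  calc (2 * Real.log (partitionFn (β / 2) (dWaveSourceTorus L 0 μ h)).re -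
        Real.log (partitionFn β (dWaveSourceTorus L 0 μ h)).re) * β ^ 2
      ≤ (∑ k : TorusSite 2 L, 4 * Real.exp (-(β / 2 * |torusBand L k - μ|))) * β ^ 2 :=
        mul_le_mul_of_nonneg_right hkey (by positivity)
    _ ≤ 4 * (A * ((L : ℝ) ^ 2 / (β / 2) + L)) * β ^ 2 := by
        rw [← Finset.mul_sum]
        gcongr
    _ = 8 * A * (L : ℝ) ^ 2 * β + 4 * (A * L * β) * β := by
        field_simp
        ring
    _ ≤ 8 * A * (L : ℝ) ^ 2 * β + 4 * (A * L * L) * β := by gcongr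
    _ = 12 * A * (β * (L : ℝ) ^ 2) := by ring

end Summit.HubbardSuperconductivity.HubbardSuperconductivity.Theorems
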